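import Mathlib.Analysis.InnerProductSpace.LaxMilgram
import Mathlib.Analysis.InnerProductSpace.Completion
import Mathlib.Analysis.Normed.Operator.Extend
import Mathlib.Analysis.Normed.Module.Completion
import Mathlib.Geometry.Manifold.Algebra.SmoothFunctions
import Literature.Geometry.Lorentzian.AFSobolev
import HarnessLib

/-!
# Weak existence for `Δ_h v − f v = g` on a Riemannian 3-manifold with a Sobolev inequality
# (Schoen–Yau 1979, Lemma 3.2 — the existence half, in the energy space)

Schoen–Yau, Comm. Math. Phys. 65 (1979), **Lemma 3.2** (p. 64): on a one-ended asymptotically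
flat `3`-manifold `N` satisfying (1.1) with zero mass, for functions `f, h` with the decay (3.3),
*"there is a number `ε₀ > 0` depending only on `N` and `k₁, k₂, k₃` of (1.1) so that if
`(∫_N |f₋|^{3/2})^{2/3} ≤ ε₀`, then (3.2) `Δv − fv = h` has a unique solution `v` defined on `N`
satisfying `v = O(1/r)`"*, with the `L⁶` bound (3.5)
`(∫ v⁶)^{1/6} ≤ c₃ (∫ |h|^{6/5})^{5/6}`. The printed existence proof (pp. 64–65) solves the
Dirichlet problems (3.4) on the exhausting domains `N^σ` ("standard linear elliptic theory
[18, p. 262]"), the solvability resting on the energy identity obtained by *"multiplying by `v_σ`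
and integrating by parts"* together with the Sobolev inequality of Lemma 3.1: *"if `h = 0`, we
can apply Lemma 3.1 to obtain `∫ ‖Dv‖² ≤ ε₀ c₁ ∫ ‖Dv‖²`. Thus if we choose `ε₀ < 1/c₁`, we see
that `Δv − fv` has trivial kernel"* (coercivity), and passes to the limit `σ → ∞` by (3.5).

This file **proves the existence statement in the energy space**, i.e. the functional-analytic
core of Lemma 3.2, on any Riemannian `3`-manifold `(X, h)` (Hausdorff, σ-compact, without
boundary) satisfying the Sobolev inequality `(∫ |ζ|⁶ dV)^{1/3} ≤ c₁ ∫ h⁻¹(dζ, dζ) dV` for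
`ζ ∈ C¹_c(X)` — proved for one-ended asymptotically flat data as `AFEnd.sobolev_inequality`
(`AFSobolev.lean`, Lemma 3.1) and, uniformly along the family `ds² + t Ric`, as
`AFEnd.exists_uniform_constants_ricciFamily` (`RicciVariationUniformConstants.lean`):

* `exists_veryWeakSolution_of_sobolev` — for continuous `f, g` with `|f|^{3/2}` and `|g|^{6/5}`
  integrable and `θ = c₁ (∫ f₋^{3/2} dV)^{2/3} < 1` there is `u ∈ L⁶(X, dV)` with
  **`‖u‖₆ ≤ c₁ ‖g‖_{6/5} / (1 − θ)`** ((3.5)) and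
  **`∫ u (Δ_h ζ − f ζ) dV = ∫ g ζ dV` for all `ζ ∈ C²_c(X)`** — a distributional solution of
  `Δ_h u − f u = g`.

*Method.* The exhaustion (3.4) is replaced by the Lax–Milgram theorem (Gilbarg–Trudinger,
Thm. 5.8; Mathlib's `IsCoercive.continuousLinearEquivOfBilin`) on the completion `H` of the
pre-Hilbert space `C²_c(X)` with the Dirichlet inner product `⟨φ, ψ⟩ = ∫ h⁻¹(dφ, dψ) dV` (a
genuine inner product by the Sobolev inequality and the positivity of the Riemannian measure on
open sets): the form `B(φ, ψ) = ⟨φ, ψ⟩ + ∫ f φ ψ dV` is bounded —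
`|∫ f φ ψ| ≤ c₁ ‖f‖_{3/2} ‖φ‖ ‖ψ‖` (`abs_integral_potential_le_of_sobolev`: Cauchy–Schwarz,
Hölder `(3/2, 3)`, Sobolev) — and coercive, `B(φ, φ) ≥ (1 − θ) ‖φ‖²`
(`integral_negPart_mul_sq_le_of_sobolev`, the printed kernel argument); the functional
`ℓ(ψ) = −∫ g ψ dV` satisfies `|ℓ(ψ)| ≤ ‖g‖_{6/5} √c₁ ‖ψ‖` (`abs_integral_source_le_of_sobolev`,
Hölder `(6/5, 6)` and Sobolev, as on p. 65). The abstract step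
(`exists_cauchySeq_tendsto_of_coercive`: extension of `B`, `ℓ` to `H`, Lax–Milgram, Riesz)
returns a Cauchy sequence `v_n ∈ C²_c(X)` with `B(v_n, ζ) → ℓ(ζ)` and `‖v_n‖ → ‖u_H‖ ≤ ‖ℓ‖/(1−θ)`;
by the Sobolev inequality `(v_n)` is Cauchy in `L⁶` and converges to `u`, and Green's identity
`∫ h⁻¹(dv_n, dζ) dV = −∫ v_n Δ_h ζ dV` (`GreenIdentityCompactSupport.lean`) gives
`B(v_n, ζ) = ∫ v_n (f ζ − Δ_h ζ) → ∫ u (f ζ − Δ_h ζ)`, whence the identity. No named facts and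
no definitions are introduced (the Hilbert-space structure on `C²_c(X)` is local to the proof).

What this does *not* yet give towards Lemma 3.2 as printed: interior regularity of the
distributional solution (elliptic regularity, `Literature.Analysis.Distribution.Folland1995_cor634`)
and the decay `v = O(1/r)` with the expansion `v = A/r + ω` ((3.6)–(3.20)); uniqueness among
`O(1/r)` solutions is `AFEnd.eq_of_dalembertian_sub_mul_eq` (`AFLinearUniqueness.lean`).

## References

* R. Schoen, S.-T. Yau, *On the proof of the positive mass conjecture in general relativity*,
  Comm. Math. Phys. 65 (1979) 45–76, Lemma 3.1 (p. 63), Lemma 3.2 and its proof, (3.2)–(3.5)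
  (pp. 64–65). [SchoenYauPMT1979]
* D. Gilbarg, N. S. Trudinger, *Elliptic Partial Differential Equations of Second Order*,
  Classics in Mathematics, Springer 2001, Thm. 5.8 (Lax–Milgram), §8.2. [GilbargTrudinger2001]
-/

noncomputable section

open Set Function Filter Topology MeasureTheory Measure TopologicalSpace Manifold Bundle Module
  UniformSpace InnerProductSpace
open scoped Manifold ContDiff ENNReal RealInnerProductSpace

namespace Literature.Geometry.Lorentzian

/-! ### Lax–Milgram on a dense subspace -/

section LaxMilgram

/-- **Lax–Milgram on a Hilbert space containing `V` densely, read back on `V`.** Let `V` be a real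
inner product space embedded isometrically and densely in a real Hilbert space `H` by `ι`, `B₀` a
continuous bilinear form on `V` with `m ‖v‖² ≤ B₀ v v` (`m > 0`) and `ℓ₀` a continuous linear
functional on `V`. Then there is a Cauchy sequence `v n` in `V` (converging in `H` to the
Lax–Milgram solution `u` of `B u = ℓ` for the extended forms, Mathlib's
`IsCoercive.continuousLinearEquivOfBilin`) with `B₀ (v n) w → ℓ₀ w` for every `w ∈ V` and
`‖v n‖ → ‖u‖ ≤ ‖ℓ₀‖ / m`. Gilbarg–Trudinger, Thm. 5.8 (Lax–Milgram). [cite: GilbargTrudinger2001, Thm. 5.8] -/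
theorem exists_cauchySeq_tendsto_of_coercive_of_denseRange
    {V : Type*} [NormedAddCommGroup V] [InnerProductSpace ℝ V]
    {H : Type*} [NormedAddCommGroup H] [InnerProductSpace ℝ H] [CompleteSpace H]
    (ι : V →L[ℝ] H) (hd : DenseRange ι) (hui : IsUniformInducing ι) (hnorm : ∀ v, ‖ι v‖ = ‖v‖)
    (B₀ : V →L[ℝ] V →L[ℝ] ℝ) (ℓ₀ : V →L[ℝ] ℝ) {m : ℝ} (hm : 0 < m)
    (hcoer : ∀ v, m * ‖v‖ ^ 2 ≤ B₀ v v) :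
    ∃ v : ℕ → V, CauchySeq v ∧ (∀ w, Tendsto (fun n ↦ B₀ (v n) w) atTop (𝓝 (ℓ₀ w))) ∧
      ∃ L, L ≤ ‖ℓ₀‖ / m ∧ Tendsto (fun n ↦ ‖v n‖) atTop (𝓝 L) := by
  have hN1 : ∀ v : V, ‖v‖ ≤ (1 : NNReal) * ‖ι v‖ := fun v ↦ by
    rw [hnorm, NNReal.coe_one, one_mul]
  -- first extension: `v ↦ (B₀ v).extend ι`, linear in `v` by uniqueness of the extension
  have hext_add : ∀ v w : V, (B₀ (v + w)).extend ι = (B₀ v).extend ι + (B₀ w).extend ι := by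
    intro v w
    refine ContinuousLinearMap.extend_unique _ hd hui _ ?_
    ext x
    simp [ContinuousLinearMap.extend_eq _ hd hui]
  have hext_smul : ∀ (c : ℝ) (v : V), (B₀ (c • v)).extend ι = c • (B₀ v).extend ι := by
    intro c v
    refine ContinuousLinearMap.extend_unique _ hd hui _ ?_
    ext x
    simp [ContinuousLinearMap.extend_eq _ hd hui]
  obtain ⟨F, hF⟩ : ∃ F : V →ₗ[ℝ] (H →L[ℝ] ℝ), ∀ v, F v = (B₀ v).extend ι :=
    ⟨{ toFun := fun v ↦ (B₀ v).extend ι, map_add' := hext_add, map_smul' := hext_smul },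
      fun _ ↦ rfl⟩
  have hFb : ∀ v, ‖F v‖ ≤ ‖B₀‖ * ‖v‖ := by
    intro v
    calc ‖F v‖ = ‖(B₀ v).extend ι‖ := by rw [hF]
      _ ≤ (1 : NNReal) * ‖B₀ v‖ := ContinuousLinearMap.opNorm_extend_le _ hd hN1
      _ = ‖B₀ v‖ := by rw [NNReal.coe_one, one_mul]
      _ ≤ ‖B₀‖ * ‖v‖ := B₀.le_opNorm v
  have hF'ex : ∃ F' : V →L[ℝ] (H →L[ℝ] ℝ), ∀ v, F' v = (B₀ v).extend ι := by
    let F' : V →L[ℝ] (H →L[ℝ] ℝ) := F.mkContinuous ‖B₀‖ hFb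
    refine ⟨F', fun v ↦ ?_⟩
    change F v = _
    rw [hF]
  obtain ⟨F', hF'⟩ := hF'ex
  obtain ⟨B, hB⟩ : ∃ B : H →L[ℝ] H →L[ℝ] ℝ, B = F'.extend ι := ⟨_, rfl⟩
  have hBι : ∀ v w : V, B (ι v) (ι w) = B₀ v w := by
    intro v w
    rw [hB, ContinuousLinearMap.extend_eq _ hd hui, hF', ContinuousLinearMap.extend_eq _ hd hui]
  -- coercivity passes to `H` by density
  have hBcoer : ∀ z : H, m * ‖z‖ ^ 2 ≤ B z z := by
    have hcont : Continuous fun z : H ↦ B z z :=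
      (ContinuousLinearMap.continuous₂ B).comp (continuous_id.prodMk continuous_id)
    have hcl : IsClosed {z : H | m * ‖z‖ ^ 2 ≤ B z z} :=
      isClosed_le (continuous_const.mul (continuous_norm.pow 2)) hcont
    intro z
    refine hd.induction_on z hcl fun v ↦ ?_
    show m * ‖ι v‖ ^ 2 ≤ B (ι v) (ι v)
    rw [hBι, hnorm]
    exact hcoer v
  have hIC : IsCoercive B := ⟨m, hm, fun z ↦ by rw [mul_assoc, ← sq]; exact hBcoer z⟩
  -- the functional and the Lax–Milgram solution
  obtain ⟨ℓ, hℓ⟩ : ∃ ℓ : H →L[ℝ] ℝ, ℓ = ℓ₀.extend ι := ⟨_, rfl⟩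
  have hℓι : ∀ w : V, ℓ (ι w) = ℓ₀ w := fun w ↦ by rw [hℓ, ContinuousLinearMap.extend_eq _ hd hui]
  have hℓn : ‖ℓ‖ ≤ ‖ℓ₀‖ := by
    calc ‖ℓ‖ ≤ (1 : NNReal) * ‖ℓ₀‖ := by rw [hℓ]; exact ContinuousLinearMap.opNorm_extend_le _ hd hN1
      _ = ‖ℓ₀‖ := by rw [NNReal.coe_one, one_mul]
  obtain ⟨y, hy⟩ : ∃ y : H, y = (toDual ℝ H).symm ℓ := ⟨_, rfl⟩
  obtain ⟨u, hu⟩ : ∃ u : H, u = hIC.continuousLinearEquivOfBilin.symm y := ⟨_, rfl⟩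
  have hBu : ∀ w : H, B u w = ℓ w := by
    intro w
    rw [← hIC.continuousLinearEquivOfBilin_apply, hu, ContinuousLinearEquiv.apply_symm_apply, hy,
      toDual_symm_apply]
  have hun : ‖u‖ ≤ ‖ℓ₀‖ / m := by
    rw [le_div_iff₀ hm]
    have h1 : m * ‖u‖ ^ 2 ≤ ‖ℓ₀‖ * ‖u‖ := by
      calc m * ‖u‖ ^ 2 ≤ B u u := hBcoer u
        _ = ℓ u := hBu u
        _ ≤ ‖ℓ u‖ := Real.le_norm_self _
        _ ≤ ‖ℓ‖ * ‖u‖ := ℓ.le_opNorm u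
        _ ≤ ‖ℓ₀‖ * ‖u‖ := mul_le_mul_of_nonneg_right hℓn (norm_nonneg _)
    by_cases hu0 : ‖u‖ = 0
    · rw [hu0, zero_mul]; positivity
    · have hpos : 0 < ‖u‖ := lt_of_le_of_ne (norm_nonneg _) (Ne.symm hu0)
      nlinarith
  -- a sequence in `V` converging to `u` in `H`
  have hmem : u ∈ closure (Set.range ι) := by
    rw [hd.closure_range]; exact Set.mem_univ _
  obtain ⟨x, hx, hxu⟩ := mem_closure_iff_seq_limit.1 hmem
  choose v hv using hx
  have hvu : Tendsto (fun n ↦ ι (v n)) atTop (𝓝 u) := by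
    simp_rw [hv]; exact hxu
  refine ⟨v, ?_, ?_, ‖u‖, hun, ?_⟩
  · have hc : Cauchy (map (fun n ↦ ι (v n)) atTop) := hvu.cauchySeq
    rw [show (fun n ↦ ι (v n)) = ι ∘ v from rfl, ← Filter.map_map] at hc
    exact hui.cauchy_map_iff.1 hc
  · intro w
    have hcw : Continuous fun z : H ↦ B z (ι w) :=
      (ContinuousLinearMap.continuous₂ B).comp (continuous_id.prodMk continuous_const)
    have := (hcw.tendsto u).comp hvu
    simp only [Function.comp_def, hBι, hBu, hℓι] at this
    exact this
  · have := (continuous_norm.tendsto u).comp hvu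
    simp only [Function.comp_def, hnorm] at this
    exact this

/-- **Lax–Milgram on the completion, read back on the dense subspace.** Let `V` be a real inner
product space (not necessarily complete), `B₀` a continuous bilinear form on `V` with
`m ‖v‖² ≤ B₀ v v` (`m > 0`) and `ℓ₀` a continuous linear functional on `V`. Then there is a Cauchy
sequence `v n` in `V` (converging, in the completion of `V`, to the Lax–Milgram solution `u` of the
extended problem) with `B₀ (v n) w → ℓ₀ w` for every `w ∈ V` and `‖v n‖ → ‖u‖ ≤ ‖ℓ₀‖ / m`.
Gilbarg–Trudinger, Thm. 5.8. [cite: GilbargTrudinger2001, Thm. 5.8] -/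
theorem exists_cauchySeq_tendsto_of_coercive
    {V : Type*} [NormedAddCommGroup V] [InnerProductSpace ℝ V]
    (B₀ : V →L[ℝ] V →L[ℝ] ℝ) (ℓ₀ : V →L[ℝ] ℝ) {m : ℝ} (hm : 0 < m)
    (hcoer : ∀ v, m * ‖v‖ ^ 2 ≤ B₀ v v) :
    ∃ v : ℕ → V, CauchySeq v ∧ (∀ w, Tendsto (fun n ↦ B₀ (v n) w) atTop (𝓝 (ℓ₀ w))) ∧
      ∃ L, L ≤ ‖ℓ₀‖ / m ∧ Tendsto (fun n ↦ ‖v n‖) atTop (𝓝 L) :=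
  exists_cauchySeq_tendsto_of_coercive_of_denseRange (H := Completion V) Completion.toComplL
    (by rw [Completion.coe_toComplL]; exact Completion.denseRange_coe)
    (by rw [Completion.coe_toComplL]; exact Completion.isUniformInducing_coe V)
    (fun v ↦ Completion.norm_coe v) B₀ ℓ₀ hm hcoer

end LaxMilgram

/-! ### `L⁶` norms and Hölder pairings -/

section LpSix

variable {X : Type*} [MeasurableSpace X] {μ : Measure X}

/-! ### `L⁶` norms and Hölder pairings -/

/-- The norm of `F ∈ L⁶(μ)` is `(∫ |F|⁶ dμ)^{1/6}`. [folklore] -/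
private theorem norm_Lp_six_eq (F : Lp ℝ 6 μ) : ‖F‖ = (∫ x, |F x| ^ 6 ∂μ) ^ (1 / 6 : ℝ) := by
  rw [Lp.norm_def, (Lp.memLp F).eLpNorm_eq_integral_rpow_norm (by norm_num) (by norm_num),
    ENNReal.toReal_ofReal (by positivity)]
  have h6 : ((6 : ℝ≥0∞)).toReal = 6 := by norm_num
  simp only [h6, Real.norm_eq_abs, one_div]
  congr 1
  refine integral_congr_ae (Eventually.of_forall fun x ↦ ?_)
  simp only
  rw [show (6 : ℝ) = ((6 : ℕ) : ℝ) by norm_num, Real.rpow_natCast]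

/-- `∫ |F|⁶ dμ = ‖F‖⁶` for `F ∈ L⁶(μ)`. [folklore] -/
private theorem integral_pow_six_eq_norm_pow (F : Lp ℝ 6 μ) : ∫ x, |F x| ^ 6 ∂μ = ‖F‖ ^ 6 := by
  rw [norm_Lp_six_eq, ← Real.rpow_natCast _ 6,
    ← Real.rpow_mul (integral_nonneg fun x ↦ by positivity)]
  norm_num

/-- `|F|⁶` is integrable for `F ∈ L⁶(μ)`. [folklore] -/
private theorem integrable_pow_six_of_Lp (F : Lp ℝ 6 μ) : Integrable (fun x ↦ |F x| ^ 6) μ := by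
  have h := (Lp.memLp F).integrable_norm_rpow (by norm_num) (by norm_num)
  refine h.congr (Eventually.of_forall fun x ↦ ?_)
  simp only [Real.norm_eq_abs]
  rw [show ((6 : ℝ≥0∞)).toReal = ((6 : ℕ) : ℝ) by norm_num, Real.rpow_natCast]

/-- **Hölder, exponents `(6/5, 6)`**: `∫ |ψ| |F| ≤ (∫ |ψ|^{6/5})^{5/6} (∫ |F|⁶)^{1/6}`. [folklore] -/
private theorem integral_abs_mul_abs_le_holder {ψ F : X → ℝ}
    (hψ : MemLp (fun x ↦ |ψ x|) (ENNReal.ofReal (6 / 5)) μ)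
    (hF : MemLp (fun x ↦ |F x|) (ENNReal.ofReal 6) μ) :
    ∫ x, |ψ x| * |F x| ∂μ ≤
      (∫ x, |ψ x| ^ (6 / 5 : ℝ) ∂μ) ^ (5 / 6 : ℝ) * (∫ x, |F x| ^ 6 ∂μ) ^ (1 / 6 : ℝ) := by
  have hpq : (6 / 5 : ℝ).HolderConjugate 6 := Real.holderConjugate_iff.2 ⟨by norm_num, by norm_num⟩
  have h := integral_mul_le_Lp_mul_Lq_of_nonneg hpq (Eventually.of_forall fun x ↦ abs_nonneg _)
    (Eventually.of_forall fun x ↦ abs_nonneg (F x)) hψ hF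
  have hF6 : ∀ x, |F x| ^ (6 : ℝ) = |F x| ^ 6 := fun x ↦ by
    rw [show (6 : ℝ) = ((6 : ℕ) : ℝ) by norm_num, Real.rpow_natCast]
  have h65 : (1 / (6 / 5) : ℝ) = 5 / 6 := by norm_num
  rw [h65, integral_congr_ae (Eventually.of_forall hF6)] at h
  exact h

/-- `|g| ∈ L^{6/5}` when `|g|^{6/5}` is integrable and `g` is a.e. strongly measurable. [folklore] -/
private theorem memLp_abs_of_integrable_rpow {g : X → ℝ} (hg : AEStronglyMeasurable g μ)
    (hgi : Integrable (fun x ↦ |g x| ^ (6 / 5 : ℝ)) μ) :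
    MemLp (fun x ↦ |g x|) (ENNReal.ofReal (6 / 5)) μ := by
  refine (integrable_norm_rpow_iff (μ := μ) hg.norm
    (p := ENNReal.ofReal (6 / 5)) (by simp) (by simp)).1 ?_
  rw [ENNReal.toReal_ofReal (by norm_num : (0 : ℝ) ≤ 6 / 5)]
  refine hgi.congr (Eventually.of_forall fun x ↦ ?_)
  simp only [Real.norm_eq_abs, abs_abs]

/-- `|F| ∈ L⁶` (exponent written `ENNReal.ofReal 6`) for `F ∈ L⁶`. [folklore] -/
private theorem memLp_abs_ofReal_six {F : X → ℝ} (hF : MemLp F 6 μ) :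
    MemLp (fun x ↦ |F x|) (ENNReal.ofReal 6) μ := by
  rw [show ENNReal.ofReal 6 = 6 by norm_num]
  exact hF.abs

/-- The Hölder triple `(6/5, 6, 1)`. [folklore] -/
private theorem holderTriple_six_fifths_six : ENNReal.HolderTriple (6 / 5 : ℝ≥0∞) 6 1 := by
  refine ⟨?_⟩
  rw [inv_one, ENNReal.inv_div (Or.inl (by norm_num)) (Or.inl (by norm_num)),
    show (6 : ℝ≥0∞)⁻¹ = 1 / 6 from (one_div (6 : ℝ≥0∞)).symm, ENNReal.div_add_div_same,
    show (5 : ℝ≥0∞) + 1 = 6 by norm_num]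
  exact ENNReal.div_self (by norm_num) (by simp)

/-- For `ψ ∈ L^{6/5}` bounded... (we only need:) `ψ F` is integrable for `ψ ∈ L^{6/5}`, `F ∈ L⁶`.
[folklore] -/
private theorem integrable_mul_of_memLp_six {ψ F : X → ℝ} (hψ : MemLp ψ (6 / 5 : ℝ≥0∞) μ)
    (hF : MemLp F 6 μ) : Integrable (fun x ↦ ψ x * F x) μ := by
  haveI := holderTriple_six_fifths_six
  exact memLp_one_iff_integrable.1 (MemLp.mul' hF hψ)

end LpSix

section Pairings

variable {X : Type*} [MeasurableSpace X] [TopologicalSpace X] [OpensMeasurableSpace X]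
  {μ : Measure X} [IsFiniteMeasureOnCompacts μ]

/-- For a continuous compactly supported `φ`, the `L⁶` class of `φ` has norm `(∫ |φ|⁶)^{1/6}`.
[folklore] -/
private theorem norm_toLp_six_eq {φ : X → ℝ} (hφ : Continuous φ) (hφc : HasCompactSupport φ) :
    ‖(hφ.memLp_of_hasCompactSupport (μ := μ) (p := 6) hφc).toLp φ‖ =
      (∫ x, |φ x| ^ 6 ∂μ) ^ (1 / 6 : ℝ) := by
  rw [norm_Lp_six_eq]
  congr 1
  refine integral_congr_ae ?_
  filter_upwards [(hφ.memLp_of_hasCompactSupport (μ := μ) (p := 6) hφc).coeFn_toLp] with x hx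
  rw [hx]

/-- **Hölder, exponents `(3/2, 3)`**: `∫ F w² ≤ (∫ F^{3/2})^{2/3} (∫ |w|⁶)^{1/3}` for `F ≥ 0`
continuous with `F^{3/2}` integrable and `w ∈ C_c(X)`. [folklore] -/
private theorem integral_mul_sq_le_of_nonneg {F w : X → ℝ} (hF : Continuous F) (hF0 : ∀ x, 0 ≤ F x)
    (hFi : Integrable (fun x ↦ F x ^ (3 / 2 : ℝ)) μ) (hw : Continuous w)
    (hwc : HasCompactSupport w) :
    ∫ x, F x * w x ^ 2 ∂μ ≤
      (∫ x, F x ^ (3 / 2 : ℝ) ∂μ) ^ (2 / 3 : ℝ) * (∫ x, |w x| ^ 6 ∂μ) ^ (1 / 3 : ℝ) := by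
  have hpq : (3 / 2 : ℝ).HolderConjugate 3 := Real.holderConjugate_iff.2 ⟨by norm_num, by norm_num⟩
  have hFLp : MemLp F (ENNReal.ofReal (3 / 2)) μ := by
    refine (integrable_norm_rpow_iff (μ := μ) hF.aestronglyMeasurable
      (p := ENNReal.ofReal (3 / 2)) (by simp) (by simp)).1 ?_
    rw [ENNReal.toReal_ofReal (by norm_num : (0 : ℝ) ≤ 3 / 2)]
    refine hFi.congr (Eventually.of_forall fun x ↦ ?_)
    change F x ^ (3 / 2 : ℝ) = ‖F x‖ ^ (3 / 2 : ℝ)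
    rw [Real.norm_eq_abs, abs_of_nonneg (hF0 x)]
  have hwc2 : HasCompactSupport (fun x ↦ w x ^ 2) :=
    hwc.comp_left (g := fun t : ℝ ↦ t ^ 2) (by simp)
  have hw2Lp : MemLp (fun x ↦ w x ^ 2) (ENNReal.ofReal 3) μ :=
    (hw.pow 2).memLp_of_hasCompactSupport hwc2
  have h := integral_mul_le_Lp_mul_Lq_of_nonneg hpq (Eventually.of_forall hF0)
    (Eventually.of_forall fun x ↦ sq_nonneg (w x)) hFLp hw2Lp
  have hw6 : ∀ x, (w x ^ 2) ^ (3 : ℝ) = |w x| ^ 6 := fun x ↦ by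
    rw [← sq_abs (w x), show (3 : ℝ) = ((3 : ℕ) : ℝ) by norm_num, Real.rpow_natCast, ← pow_mul]
  have h23 : (1 / (3 / 2) : ℝ) = 2 / 3 := by norm_num
  rw [h23, integral_congr_ae (Eventually.of_forall hw6)] at h
  exact h

/-- **Cauchy–Schwarz for `∫ F |u| |w|`**: `∫ F |u| |w| ≤ (∫ F u²)^{1/2} (∫ F w²)^{1/2}` for
`F ≥ 0`, `F, u, w` continuous, `u, w` compactly supported. [folklore] -/
private theorem integral_mul_abs_mul_abs_le {F u w : X → ℝ} (hF : Continuous F) (hF0 : ∀ x, 0 ≤ F x)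
    (hu : Continuous u) (huc : HasCompactSupport u) (hw : Continuous w)
    (hwc : HasCompactSupport w) :
    ∫ x, F x * |u x| * |w x| ∂μ ≤
      (∫ x, F x * u x ^ 2 ∂μ) ^ (1 / 2 : ℝ) * (∫ x, F x * w x ^ 2 ∂μ) ^ (1 / 2 : ℝ) := by
  have hpq : (2 : ℝ).HolderConjugate 2 := Real.holderConjugate_iff.2 ⟨by norm_num, by norm_num⟩
  obtain ⟨a, ha⟩ : ∃ a : X → ℝ, a = fun x ↦ Real.sqrt (F x) * |u x| := ⟨_, rfl⟩
  obtain ⟨b, hb⟩ : ∃ b : X → ℝ, b = fun x ↦ Real.sqrt (F x) * |w x| := ⟨_, rfl⟩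
  have hac : Continuous a := by rw [ha]; exact (hF.sqrt).mul hu.abs
  have hbc : Continuous b := by rw [hb]; exact (hF.sqrt).mul hw.abs
  have huca : HasCompactSupport (fun x ↦ |u x|) := huc.comp_left (g := fun t : ℝ ↦ |t|) (by simp)
  have hwca : HasCompactSupport (fun x ↦ |w x|) := hwc.comp_left (g := fun t : ℝ ↦ |t|) (by simp)
  have hacs : HasCompactSupport a := by rw [ha]; exact huca.mul_left
  have hbcs : HasCompactSupport b := by rw [hb]; exact hwca.mul_left
  have haLp : MemLp a (ENNReal.ofReal 2) μ := hac.memLp_of_hasCompactSupport hacs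
  have hbLp : MemLp b (ENNReal.ofReal 2) μ := hbc.memLp_of_hasCompactSupport hbcs
  have ha0 : ∀ x, 0 ≤ a x := fun x ↦ by rw [ha]; exact mul_nonneg (Real.sqrt_nonneg _) (abs_nonneg _)
  have hb0 : ∀ x, 0 ≤ b x := fun x ↦ by rw [hb]; exact mul_nonneg (Real.sqrt_nonneg _) (abs_nonneg _)
  have h := integral_mul_le_Lp_mul_Lq_of_nonneg hpq (Eventually.of_forall ha0)
    (Eventually.of_forall hb0) haLp hbLp
  have ha2 : ∀ x, a x ^ (2 : ℝ) = F x * u x ^ 2 := fun x ↦ by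
    rw [show (2 : ℝ) = ((2 : ℕ) : ℝ) by norm_num, Real.rpow_natCast, ha]
    simp only [mul_pow, Real.sq_sqrt (hF0 x), sq_abs]
  have hb2 : ∀ x, b x ^ (2 : ℝ) = F x * w x ^ 2 := fun x ↦ by
    rw [show (2 : ℝ) = ((2 : ℕ) : ℝ) by norm_num, Real.rpow_natCast, hb]
    simp only [mul_pow, Real.sq_sqrt (hF0 x), sq_abs]
  have hab : ∀ x, a x * b x = F x * |u x| * |w x| := fun x ↦ by
    rw [ha, hb]
    calc Real.sqrt (F x) * |u x| * (Real.sqrt (F x) * |w x|)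
        = (Real.sqrt (F x) * Real.sqrt (F x)) * |u x| * |w x| := by ring
      _ = F x * |u x| * |w x| := by rw [Real.mul_self_sqrt (hF0 x)]
  rw [integral_congr_ae (Eventually.of_forall hab), integral_congr_ae (Eventually.of_forall ha2),
    integral_congr_ae (Eventually.of_forall hb2)] at h
  exact h

/-- **Weak-star continuity of the pairing with `C_c`**: if `Fₙ → U` in `L⁶(μ)` and `ψ ∈ C_c(X)`,
then `∫ ψ Fₙ → ∫ ψ U` (Hölder). [folklore] -/
private theorem tendsto_integral_mul_of_tendsto_Lp [Fact (1 ≤ (6 : ℝ≥0∞))] {Fn : ℕ → Lp ℝ 6 μ} {U : Lp ℝ 6 μ}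
    (hFU : Tendsto Fn atTop (𝓝 U)) {ψ : X → ℝ} (hψ : Continuous ψ) (hψc : HasCompactSupport ψ) :
    Tendsto (fun n ↦ ∫ x, ψ x * Fn n x ∂μ) atTop (𝓝 (∫ x, ψ x * U x ∂μ)) := by
  have hψ65 : MemLp ψ (6 / 5 : ℝ≥0∞) μ := hψ.memLp_of_hasCompactSupport hψc
  have hψca : HasCompactSupport (fun x ↦ |ψ x|) := hψc.comp_left (g := fun t : ℝ ↦ |t|) (by simp)
  have hψa : MemLp (fun x ↦ |ψ x|) (ENNReal.ofReal (6 / 5)) μ :=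
    hψ.abs.memLp_of_hasCompactSupport hψca
  set C : ℝ := (∫ x, |ψ x| ^ (6 / 5 : ℝ) ∂μ) ^ (5 / 6 : ℝ) with hC
  have hC0 : 0 ≤ C := by positivity
  rw [Metric.tendsto_atTop] at hFU ⊢
  intro ε hε
  obtain ⟨N, hN⟩ := hFU (ε / (C + 1)) (div_pos hε (by positivity))
  refine ⟨N, fun n hn ↦ ?_⟩
  have hdist := hN n hn
  rw [dist_eq_norm] at hdist
  -- `∫ ψ Fₙ − ∫ ψ U = ∫ ψ (Fₙ − U)`
  have hiF : Integrable (fun x ↦ ψ x * Fn n x) μ := integrable_mul_of_memLp_six hψ65 (Lp.memLp _)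
  have hiU : Integrable (fun x ↦ ψ x * U x) μ := integrable_mul_of_memLp_six hψ65 (Lp.memLp _)
  have hsub : ∫ x, ψ x * Fn n x ∂μ - ∫ x, ψ x * U x ∂μ = ∫ x, ψ x * (Fn n - U) x ∂μ := by
    rw [← integral_sub hiF hiU]
    refine integral_congr_ae ?_
    filter_upwards [Lp.coeFn_sub (Fn n) U] with x hx
    rw [hx, Pi.sub_apply, mul_sub]
  rw [Real.dist_eq, hsub]
  have hH : MemLp (fun x ↦ |(Fn n - U) x|) (ENNReal.ofReal 6) μ := memLp_abs_ofReal_six (Lp.memLp _)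
  calc |∫ x, ψ x * (Fn n - U) x ∂μ| ≤ ∫ x, |ψ x * (Fn n - U) x| ∂μ := abs_integral_le_integral_abs
    _ = ∫ x, |ψ x| * |(Fn n - U) x| ∂μ := by simp only [abs_mul]
    _ ≤ C * (∫ x, |(Fn n - U) x| ^ 6 ∂μ) ^ (1 / 6 : ℝ) := integral_abs_mul_abs_le_holder hψa hH
    _ = C * ‖Fn n - U‖ := by rw [norm_Lp_six_eq]
    _ ≤ C * (ε / (C + 1)) := mul_le_mul_of_nonneg_left hdist.le hC0
    _ < ε := by
        rw [mul_div_assoc', div_lt_iff₀ (by positivity)]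
        nlinarith

end Pairings



/-! ### The Dirichlet pairing `h⁻¹(du, dw)` of functions on a 3-manifold -/

section Dirichlet

variable {X : Type} [TopologicalSpace X] [ChartedSpace E3 X] [IsManifold (𝓡 3) ∞ X]
  (D : InitialDataSet (𝓡 3) X)

omit [IsManifold (𝓡 3) ∞ X] in
/-- `d(c u) = c du` for the vector-valued manifold derivative of a real function. [folklore] -/
private theorem mvfderiv_const_smul' (x : X) {u : X → ℝ} (hu : MDifferentiableAt (𝓡 3) 𝓘(ℝ, ℝ) u x)
    (c : ℝ) : mvfderiv (𝓡 3) (c • u) x = c • mvfderiv (𝓡 3) u x := by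
  ext v
  simp [mvfderiv, const_smul_mfderiv hu c]
  rfl

/-- Additivity of the Dirichlet pairing in the first slot: `h⁻¹(d(u + v), dw) = h⁻¹(du, dw) +
h⁻¹(dv, dw)`. [folklore] -/
theorem innerDual_mvfderiv_add_left (x : X) {u v w : X → ℝ}
    (hu : MDifferentiableAt (𝓡 3) 𝓘(ℝ, ℝ) u x) (hv : MDifferentiableAt (𝓡 3) 𝓘(ℝ, ℝ) v x) :
    D.metric.innerDual x (mvfderiv (𝓡 3) (u + v) x).toLinearMap (mvfderiv (𝓡 3) w x).toLinearMap =
      D.metric.innerDual x (mvfderiv (𝓡 3) u x).toLinearMap (mvfderiv (𝓡 3) w x).toLinearMap +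
      D.metric.innerDual x (mvfderiv (𝓡 3) v x).toLinearMap (mvfderiv (𝓡 3) w x).toLinearMap := by
  rw [mvfderiv_add hu hv]
  simp only [ContinuousLinearMap.toLinearMap_add, PseudoRiemannianMetric.innerDual,
    LinearMap.add_apply]

/-- Homogeneity of the Dirichlet pairing in the first slot: `h⁻¹(d(c u), dw) = c h⁻¹(du, dw)`.
[folklore] -/
theorem innerDual_mvfderiv_smul_left (x : X) {u w : X → ℝ}
    (hu : MDifferentiableAt (𝓡 3) 𝓘(ℝ, ℝ) u x) (c : ℝ) :
    D.metric.innerDual x (mvfderiv (𝓡 3) (c • u) x).toLinearMap (mvfderiv (𝓡 3) w x).toLinearMap =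
      c * D.metric.innerDual x (mvfderiv (𝓡 3) u x).toLinearMap (mvfderiv (𝓡 3) w x).toLinearMap := by
  rw [mvfderiv_const_smul' x hu c]
  simp only [ContinuousLinearMap.toLinearMap_smul, PseudoRiemannianMetric.innerDual,
    LinearMap.smul_apply, smul_eq_mul]

/-- Symmetry of the Dirichlet pairing: `h⁻¹(du, dw) = h⁻¹(dw, du)`. [folklore] -/
theorem innerDual_mvfderiv_comm (x : X) (u w : X → ℝ) :
    D.metric.innerDual x (mvfderiv (𝓡 3) u x).toLinearMap (mvfderiv (𝓡 3) w x).toLinearMap =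
      D.metric.innerDual x (mvfderiv (𝓡 3) w x).toLinearMap (mvfderiv (𝓡 3) u x).toLinearMap := by
  change (PseudoRiemannianMetric.ofRiemannian D.h).innerDual x _ _ =
    (PseudoRiemannianMetric.ofRiemannian D.h).innerDual x _ _
  exact innerDual_comm D.h x _ _

/-- The Dirichlet pairing `h⁻¹(du, dw)` vanishes off the topological support of `u`. [folklore] -/
private theorem innerDual_mvfderiv_eq_zero_of_notMem_tsupport_left {u w : X → ℝ} {x : X}
    (hx : x ∉ tsupport u) :
    D.metric.innerDual x (mvfderiv (𝓡 3) u x).toLinearMap (mvfderiv (𝓡 3) w x).toLinearMap = 0 := by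
  have hev : u =ᶠ[𝓝 x] fun _ ↦ 0 := notMem_tsupport_iff_eventuallyEq.1 hx
  simp only [PseudoRiemannianMetric.mvfderiv_eq_zero_of_eventuallyEq_zero hev,
    ContinuousLinearMap.toLinearMap_zero, PseudoRiemannianMetric.innerDual, LinearMap.zero_apply]

/-- The Dirichlet pairing `h⁻¹(du, dw)` has compact support when `u` has. [folklore] -/
theorem hasCompactSupport_innerDual_mvfderiv [T2Space X] {u w : X → ℝ}
    (huc : HasCompactSupport u) :
    HasCompactSupport fun x ↦
      D.metric.innerDual x (mvfderiv (𝓡 3) u x).toLinearMap (mvfderiv (𝓡 3) w x).toLinearMap :=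
  HasCompactSupport.intro huc fun _ hx ↦ innerDual_mvfderiv_eq_zero_of_notMem_tsupport_left D hx

/-- `h⁻¹(du, du) ≥ 0`. [folklore] -/
private theorem innerDual_mvfderiv_self_nonneg (x : X) (u : X → ℝ) :
    0 ≤ D.metric.innerDual x (mvfderiv (𝓡 3) u x).toLinearMap (mvfderiv (𝓡 3) u x).toLinearMap :=
  innerDual_self_nonneg D.h x _

end Dirichlet

/-! ### Energy estimates for the pairings (Sobolev and Hölder) -/

section Estimates

variable {X : Type} [TopologicalSpace X] [ChartedSpace E3 X] [IsManifold (𝓡 3) ∞ X]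
  [T2Space X] [LocallyCompactSpace X] [MeasurableSpace X] [BorelSpace X]
  (D : InitialDataSet (𝓡 3) X)

/-- Under the Sobolev inequality `(∫ |ζ|⁶)^{1/3} ≤ c₁ ∫ h⁻¹(dζ, dζ)`, the `L⁶` norm is bounded by
the Dirichlet norm: `(∫ |ζ|⁶)^{1/6} ≤ (c₁ E(ζ))^{1/2}`. [cite: SchoenYauPMT1979, Lemma 3.1] -/
private theorem lSix_le_sqrt_of_sobolev {c₁ : ℝ}
    (hS : ∀ ζ : X → ℝ, ContMDiff (𝓡 3) 𝓘(ℝ, ℝ) 1 ζ → HasCompactSupport ζ →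
      (∫ x, |ζ x| ^ 6 ∂riemannianMeasure D.h) ^ (1 / 3 : ℝ) ≤
        c₁ * ∫ x, D.metric.innerDual x (mvfderiv (𝓡 3) ζ x).toLinearMap
          (mvfderiv (𝓡 3) ζ x).toLinearMap ∂riemannianMeasure D.h)
    {ζ : X → ℝ} (hζ : ContMDiff (𝓡 3) 𝓘(ℝ, ℝ) 1 ζ) (hζc : HasCompactSupport ζ) :
    (∫ x, |ζ x| ^ 6 ∂riemannianMeasure D.h) ^ (1 / 6 : ℝ) ≤
      Real.sqrt (c₁ * ∫ x, D.metric.innerDual x (mvfderiv (𝓡 3) ζ x).toLinearMap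
          (mvfderiv (𝓡 3) ζ x).toLinearMap ∂riemannianMeasure D.h) := by
  have h := hS ζ hζ hζc
  have hI0 : 0 ≤ ∫ x, |ζ x| ^ 6 ∂riemannianMeasure D.h := integral_nonneg fun x ↦ by positivity
  have h16 : (∫ x, |ζ x| ^ 6 ∂riemannianMeasure D.h) ^ (1 / 6 : ℝ) =
      Real.sqrt ((∫ x, |ζ x| ^ 6 ∂riemannianMeasure D.h) ^ (1 / 3 : ℝ)) := by
    rw [Real.sqrt_eq_rpow, ← Real.rpow_mul hI0]
    norm_num
  rw [h16]
  exact Real.sqrt_le_sqrt h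

/-- **The potential term is energy-bounded**: under the Sobolev inequality with constant `c₁`,
for `φ, ψ ∈ C¹_c(X)` and a continuous `f` with `|f|^{3/2}` integrable,
`|∫ f φ ψ dV| ≤ c₁ ‖f‖_{3/2} E(φ)^{1/2} E(ψ)^{1/2}`, `E(ζ) = ∫ h⁻¹(dζ, dζ) dV`
(Cauchy–Schwarz, Hölder `(3/2, 3)` and Sobolev). [cite: SchoenYauPMT1979, proof of Lemma 3.2 (p. 65)] -/
theorem abs_integral_potential_le_of_sobolev [SigmaCompactSpace X] {c₁ : ℝ} (hc₁ : 0 ≤ c₁)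
    (hS : ∀ ζ : X → ℝ, ContMDiff (𝓡 3) 𝓘(ℝ, ℝ) 1 ζ → HasCompactSupport ζ →
      (∫ x, |ζ x| ^ 6 ∂riemannianMeasure D.h) ^ (1 / 3 : ℝ) ≤
        c₁ * ∫ x, D.metric.innerDual x (mvfderiv (𝓡 3) ζ x).toLinearMap
          (mvfderiv (𝓡 3) ζ x).toLinearMap ∂riemannianMeasure D.h)
    {f : X → ℝ} (hf : Continuous f)
    (hfi : Integrable (fun x ↦ |f x| ^ (3 / 2 : ℝ)) (riemannianMeasure D.h))
    {φ ψ : X → ℝ} (hφ : ContMDiff (𝓡 3) 𝓘(ℝ, ℝ) 1 φ) (hφc : HasCompactSupport φ)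
    (hψ : ContMDiff (𝓡 3) 𝓘(ℝ, ℝ) 1 ψ) (hψc : HasCompactSupport ψ) :
    |∫ x, f x * φ x * ψ x ∂riemannianMeasure D.h| ≤
      c₁ * (∫ x, |f x| ^ (3 / 2 : ℝ) ∂riemannianMeasure D.h) ^ (2 / 3 : ℝ) *
        Real.sqrt (∫ x, D.metric.innerDual x (mvfderiv (𝓡 3) φ x).toLinearMap
          (mvfderiv (𝓡 3) φ x).toLinearMap ∂riemannianMeasure D.h) *
        Real.sqrt (∫ x, D.metric.innerDual x (mvfderiv (𝓡 3) ψ x).toLinearMap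
          (mvfderiv (𝓡 3) ψ x).toLinearMap ∂riemannianMeasure D.h) := by
  set μ : Measure X := riemannianMeasure D.h with hμ
  haveI : IsFiniteMeasureOnCompacts μ :=
    ⟨fun K hK ↦ riemannianVolume_lt_top_of_isCompact_holds D.h le_rfl hK⟩
  set Nf : ℝ := (∫ x, |f x| ^ (3 / 2 : ℝ) ∂μ) ^ (2 / 3 : ℝ) with hNf
  set Eφ : ℝ := ∫ x, D.metric.innerDual x (mvfderiv (𝓡 3) φ x).toLinearMap
    (mvfderiv (𝓡 3) φ x).toLinearMap ∂μ with hEφ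
  set Eψ : ℝ := ∫ x, D.metric.innerDual x (mvfderiv (𝓡 3) ψ x).toLinearMap
    (mvfderiv (𝓡 3) ψ x).toLinearMap ∂μ with hEψ
  have hNf0 : 0 ≤ Nf := Real.rpow_nonneg (integral_nonneg fun x ↦ by positivity) _
  have hEφ0 : 0 ≤ Eφ := integral_nonneg fun x ↦ innerDual_mvfderiv_self_nonneg D x φ
  have hEψ0 : 0 ≤ Eψ := integral_nonneg fun x ↦ innerDual_mvfderiv_self_nonneg D x ψ
  have hφc' : Continuous φ := hφ.continuous
  have hψc' : Continuous ψ := hψ.continuous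
  -- Hölder `(3/2, 3)` and Sobolev: `∫ |f| ζ² ≤ Nf (∫ |ζ|⁶)^{1/3} ≤ Nf c₁ E(ζ)`
  have hH : ∀ {ζ : X → ℝ}, ContMDiff (𝓡 3) 𝓘(ℝ, ℝ) 1 ζ → HasCompactSupport ζ →
      ∫ x, |f x| * ζ x ^ 2 ∂μ ≤ Nf * (c₁ * ∫ x, D.metric.innerDual x
        (mvfderiv (𝓡 3) ζ x).toLinearMap (mvfderiv (𝓡 3) ζ x).toLinearMap ∂μ) := by
    intro ζ hζ hζc
    have h1 := integral_mul_sq_le_of_nonneg (μ := μ) hf.abs (fun x ↦ abs_nonneg (f x))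
      (by simpa only [abs_abs] using hfi) hζ.continuous hζc
    exact h1.trans (mul_le_mul_of_nonneg_left (hS ζ hζ hζc) hNf0)
  have hφ2 := hH hφ hφc
  have hψ2 := hH hψ hψc
  -- Cauchy–Schwarz
  have hCS := integral_mul_abs_mul_abs_le (μ := μ) hf.abs (fun x ↦ abs_nonneg (f x)) hφc' hφc
    hψc' hψc
  have hint : Integrable (fun x ↦ f x * φ x * ψ x) μ := by
    have hcs : HasCompactSupport (fun x ↦ f x * φ x * ψ x) := hψc.mul_left
    exact ((hf.mul hφc').mul hψc').integrable_of_hasCompactSupport hcs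
  calc |∫ x, f x * φ x * ψ x ∂μ| ≤ ∫ x, |f x * φ x * ψ x| ∂μ := abs_integral_le_integral_abs
    _ = ∫ x, |f x| * |φ x| * |ψ x| ∂μ := by simp only [abs_mul]
    _ ≤ (∫ x, |f x| * φ x ^ 2 ∂μ) ^ (1 / 2 : ℝ) * (∫ x, |f x| * ψ x ^ 2 ∂μ) ^ (1 / 2 : ℝ) := hCS
    _ ≤ (Nf * (c₁ * Eφ)) ^ (1 / 2 : ℝ) * (Nf * (c₁ * Eψ)) ^ (1 / 2 : ℝ) := by
        gcongr
    _ = c₁ * Nf * Real.sqrt Eφ * Real.sqrt Eψ := by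
        have key : ∀ E : ℝ, (Nf * (c₁ * E)) ^ (1 / 2 : ℝ) = Real.sqrt Nf * Real.sqrt c₁ * Real.sqrt E :=
          fun E ↦ by rw [← Real.sqrt_eq_rpow, Real.sqrt_mul hNf0, Real.sqrt_mul hc₁]; ring
        have h1 : Real.sqrt Nf * Real.sqrt Nf = Nf := Real.mul_self_sqrt hNf0
        have h2 : Real.sqrt c₁ * Real.sqrt c₁ = c₁ := Real.mul_self_sqrt hc₁
        rw [key Eφ, key Eψ]
        calc Real.sqrt Nf * Real.sqrt c₁ * Real.sqrt Eφ * (Real.sqrt Nf * Real.sqrt c₁ * Real.sqrt Eψ)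
            = (Real.sqrt c₁ * Real.sqrt c₁) * (Real.sqrt Nf * Real.sqrt Nf) *
                Real.sqrt Eφ * Real.sqrt Eψ := by ring
          _ = c₁ * Nf * Real.sqrt Eφ * Real.sqrt Eψ := by rw [h1, h2]

/-- **The negative part of the potential is energy-small**: `∫ f₋ ζ² dV ≤ c₁ ‖f₋‖_{3/2} E(ζ)` for
`ζ ∈ C¹_c(X)` (Hölder `(3/2, 3)` and Sobolev) — the coercivity estimate of Schoen–Yau, p. 65
("we can apply Lemma 3.1 to obtain `∫ ‖Dv‖² ≤ ε₀ c₁ ∫ ‖Dv‖²`").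
[cite: SchoenYauPMT1979, proof of Lemma 3.2 (p. 65)] -/
theorem integral_negPart_mul_sq_le_of_sobolev [SigmaCompactSpace X] {c₁ : ℝ}
    (hS : ∀ ζ : X → ℝ, ContMDiff (𝓡 3) 𝓘(ℝ, ℝ) 1 ζ → HasCompactSupport ζ →
      (∫ x, |ζ x| ^ 6 ∂riemannianMeasure D.h) ^ (1 / 3 : ℝ) ≤
        c₁ * ∫ x, D.metric.innerDual x (mvfderiv (𝓡 3) ζ x).toLinearMap
          (mvfderiv (𝓡 3) ζ x).toLinearMap ∂riemannianMeasure D.h)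
    {f : X → ℝ} (hf : Continuous f)
    (hfi : Integrable (fun x ↦ max (-f x) 0 ^ (3 / 2 : ℝ)) (riemannianMeasure D.h))
    {ζ : X → ℝ} (hζ : ContMDiff (𝓡 3) 𝓘(ℝ, ℝ) 1 ζ) (hζc : HasCompactSupport ζ) :
    ∫ x, max (-f x) 0 * ζ x ^ 2 ∂riemannianMeasure D.h ≤
      (∫ x, max (-f x) 0 ^ (3 / 2 : ℝ) ∂riemannianMeasure D.h) ^ (2 / 3 : ℝ) *
        (c₁ * ∫ x, D.metric.innerDual x (mvfderiv (𝓡 3) ζ x).toLinearMap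
          (mvfderiv (𝓡 3) ζ x).toLinearMap ∂riemannianMeasure D.h) := by
  haveI : IsFiniteMeasureOnCompacts (riemannianMeasure D.h) :=
    ⟨fun K hK ↦ riemannianVolume_lt_top_of_isCompact_holds D.h le_rfl hK⟩
  have h1 := integral_mul_sq_le_of_nonneg (μ := riemannianMeasure D.h) (hf.neg.max continuous_const)
    (fun x ↦ le_max_right _ _) hfi hζ.continuous hζc
  exact h1.trans (mul_le_mul_of_nonneg_left (hS ζ hζ hζc)
    (Real.rpow_nonneg (integral_nonneg fun x ↦ Real.rpow_nonneg (le_max_right _ _) _) _))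

/-- **The source term is an energy-bounded functional**: `|∫ g ζ dV| ≤ ‖g‖_{6/5} (c₁ E(ζ))^{1/2}`
for `ζ ∈ C¹_c(X)` (Hölder `(6/5, 6)` and Sobolev; Schoen–Yau, p. 65: "`≤ c₁ (∫ |h|^{6/5})^{5/6}
(∫ v⁶)^{1/6}`"). [cite: SchoenYauPMT1979, proof of Lemma 3.2 (p. 65)] -/
theorem abs_integral_source_le_of_sobolev [SigmaCompactSpace X] {c₁ : ℝ}
    (hS : ∀ ζ : X → ℝ, ContMDiff (𝓡 3) 𝓘(ℝ, ℝ) 1 ζ → HasCompactSupport ζ →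
      (∫ x, |ζ x| ^ 6 ∂riemannianMeasure D.h) ^ (1 / 3 : ℝ) ≤
        c₁ * ∫ x, D.metric.innerDual x (mvfderiv (𝓡 3) ζ x).toLinearMap
          (mvfderiv (𝓡 3) ζ x).toLinearMap ∂riemannianMeasure D.h)
    {g : X → ℝ} (hg : Continuous g)
    (hgi : Integrable (fun x ↦ |g x| ^ (6 / 5 : ℝ)) (riemannianMeasure D.h))
    {ζ : X → ℝ} (hζ : ContMDiff (𝓡 3) 𝓘(ℝ, ℝ) 1 ζ) (hζc : HasCompactSupport ζ) :
    |∫ x, g x * ζ x ∂riemannianMeasure D.h| ≤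
      (∫ x, |g x| ^ (6 / 5 : ℝ) ∂riemannianMeasure D.h) ^ (5 / 6 : ℝ) *
        Real.sqrt (c₁ * ∫ x, D.metric.innerDual x (mvfderiv (𝓡 3) ζ x).toLinearMap
          (mvfderiv (𝓡 3) ζ x).toLinearMap ∂riemannianMeasure D.h) := by
  set μ : Measure X := riemannianMeasure D.h with hμ
  haveI : IsFiniteMeasureOnCompacts μ :=
    ⟨fun K hK ↦ riemannianVolume_lt_top_of_isCompact_holds D.h le_rfl hK⟩
  have hζc' : Continuous ζ := hζ.continuous
  have hgLp := memLp_abs_of_integrable_rpow (μ := μ) hg.aestronglyMeasurable hgi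
  have hζLp : MemLp (fun x ↦ |ζ x|) (ENNReal.ofReal 6) μ := by
    have hca : HasCompactSupport (fun x ↦ |ζ x|) := hζc.comp_left (g := fun t : ℝ ↦ |t|) (by simp)
    exact hζc'.abs.memLp_of_hasCompactSupport hca
  have hH := integral_abs_mul_abs_le_holder hgLp hζLp
  have hG0 : 0 ≤ (∫ x, |g x| ^ (6 / 5 : ℝ) ∂μ) ^ (5 / 6 : ℝ) :=
    Real.rpow_nonneg (integral_nonneg fun x ↦ by positivity) _
  calc |∫ x, g x * ζ x ∂μ| ≤ ∫ x, |g x * ζ x| ∂μ := abs_integral_le_integral_abs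
    _ = ∫ x, |g x| * |ζ x| ∂μ := by simp only [abs_mul]
    _ ≤ (∫ x, |g x| ^ (6 / 5 : ℝ) ∂μ) ^ (5 / 6 : ℝ) * (∫ x, |ζ x| ^ 6 ∂μ) ^ (1 / 6 : ℝ) := hH
    _ ≤ _ := mul_le_mul_of_nonneg_left (lSix_le_sqrt_of_sobolev D hS hζ hζc) hG0

end Estimates

/-! ### Weak existence (Schoen–Yau 1979, Lemma 3.2, existence) -/

section Existence

variable {X : Type} [TopologicalSpace X] [ChartedSpace E3 X] [IsManifold (𝓡 3) ∞ X]
  [T2Space X] [LocallyCompactSpace X] [SigmaCompactSpace X] [MeasurableSpace X] [BorelSpace X]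
  (D : InitialDataSet (𝓡 3) X) [D.metric.HasLeviCivita]

/-- **Weak existence for `Δ_h v − f v = g` (Schoen–Yau 1979, Lemma 3.2, existence half, in the
energy space).** Let `(X, h)` be a Riemannian `3`-manifold satisfying the Sobolev inequality
`(∫ |ζ|⁶ dV)^{1/3} ≤ c₁ ∫ h⁻¹(dζ, dζ) dV` for `ζ ∈ C¹_c(X)` (Lemma 3.1; `AFEnd.sobolev_inequality`
for one-ended asymptotically flat data), let `f, g` be continuous with `|f|^{3/2}`, `|g|^{6/5}`
integrable and `θ = c₁ (∫ f₋^{3/2} dV)^{2/3} < 1`. Then there is `u ∈ L⁶(X, dV)` with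
`‖u‖₆ ≤ c₁ ‖g‖_{6/5} / (1 − θ)` solving `Δ_h u − f u = g` in the sense of distributions:
`∫ u (Δ_h ζ − f ζ) dV = ∫ g ζ dV` for every `ζ ∈ C²_c(X)`.

*Proof* (the printed energy method, pp. 64–65, with the exhaustion by the Dirichlet problems
(3.4) replaced by the Lax–Milgram theorem on the completion `H` of `C²_c(X)` under the Dirichlet
norm `‖ζ‖² = ∫ h⁻¹(dζ, dζ) dV` — a norm by the Sobolev inequality): the form
`B(φ, ψ) = ⟨φ, ψ⟩ + ∫ f φ ψ dV` is bounded (`|∫ f φ ψ| ≤ c₁ ‖f‖_{3/2} ‖φ‖ ‖ψ‖`, Hölder and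
Sobolev) and coercive (`B(φ, φ) ≥ (1 − θ) ‖φ‖²`, "we can apply Lemma 3.1 to obtain
`∫ ‖Dv‖² ≤ ε₀ c₁ ∫ ‖Dv‖²`", p. 65), the functional `ℓ(ψ) = −∫ g ψ dV` is bounded by
`‖g‖_{6/5} √c₁ ‖ψ‖`; the Lax–Milgram solution is the limit in `H` of a Cauchy sequence
`v_n ∈ C²_c(X)`, whose images in `L⁶` converge (Sobolev) to `u`, and Green's identity
`∫ h⁻¹(dv_n, dζ) = −∫ v_n Δ_h ζ` (`GreenIdentityCompactSupport.lean`) turns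
`B(v_n, ζ) → ℓ(ζ)` into the asserted identity. The bound on `‖u‖₆` is (3.5).
[cite: SchoenYauPMT1979, Lemma 3.2 (p. 64) and its proof, (3.4)–(3.5) (p. 65)] -/
theorem exists_veryWeakSolution_of_sobolev {c₁ : ℝ} (hc₁ : 0 ≤ c₁)
    (hS : ∀ ζ : X → ℝ, ContMDiff (𝓡 3) 𝓘(ℝ, ℝ) 1 ζ → HasCompactSupport ζ →
      (∫ x, |ζ x| ^ 6 ∂riemannianMeasure D.h) ^ (1 / 3 : ℝ) ≤
        c₁ * ∫ x, D.metric.innerDual x (mvfderiv (𝓡 3) ζ x).toLinearMap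
          (mvfderiv (𝓡 3) ζ x).toLinearMap ∂riemannianMeasure D.h)
    {f g : X → ℝ} (hf : Continuous f) (hg : Continuous g)
    (hfi : Integrable (fun x ↦ |f x| ^ (3 / 2 : ℝ)) (riemannianMeasure D.h))
    (hθ : c₁ * (∫ x, max (-f x) 0 ^ (3 / 2 : ℝ) ∂riemannianMeasure D.h) ^ (2 / 3 : ℝ) < 1)
    (hgi : Integrable (fun x ↦ |g x| ^ (6 / 5 : ℝ)) (riemannianMeasure D.h)) :
    ∃ u : X → ℝ, MemLp u 6 (riemannianMeasure D.h) ∧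
      ∫ x, |u x| ^ 6 ∂riemannianMeasure D.h ≤
        (c₁ * (∫ x, |g x| ^ (6 / 5 : ℝ) ∂riemannianMeasure D.h) ^ (5 / 6 : ℝ) /
          (1 - c₁ * (∫ x, max (-f x) 0 ^ (3 / 2 : ℝ) ∂riemannianMeasure D.h) ^ (2 / 3 : ℝ))) ^ 6 ∧
      ∀ ζ : X → ℝ, ContMDiff (𝓡 3) 𝓘(ℝ, ℝ) 2 ζ → HasCompactSupport ζ →
        ∫ x, u x * (D.metric.dalembertian ζ x - f x * ζ x) ∂riemannianMeasure D.h =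
          ∫ x, g x * ζ x ∂riemannianMeasure D.h := by
  classical
  haveI : (PseudoRiemannianMetric.ofRiemannian D.h).HasLeviCivita := ‹D.metric.HasLeviCivita›
  haveI hFact : Fact (1 ≤ (6 : ℝ≥0∞)) := ⟨by norm_num⟩
  set μ : Measure X := riemannianMeasure D.h with hμ
  haveI : IsFiniteMeasureOnCompacts μ :=
    ⟨fun K hK ↦ riemannianVolume_lt_top_of_isCompact_holds D.h le_rfl hK⟩
  haveI : μ.IsOpenPosMeasure := isOpenPosMeasure_riemannianMeasure D.h
  /- constants -/
  set N : ℝ := (∫ x, max (-f x) 0 ^ (3 / 2 : ℝ) ∂μ) ^ (2 / 3 : ℝ) with hN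
  set G : ℝ := (∫ x, |g x| ^ (6 / 5 : ℝ) ∂μ) ^ (5 / 6 : ℝ) with hG
  set Nf : ℝ := (∫ x, |f x| ^ (3 / 2 : ℝ) ∂μ) ^ (2 / 3 : ℝ) with hNf
  have hN0 : 0 ≤ N := Real.rpow_nonneg (integral_nonneg fun x ↦ Real.rpow_nonneg (le_max_right _ _) _) _
  have hG0 : 0 ≤ G := Real.rpow_nonneg (integral_nonneg fun x ↦ by positivity) _
  have hNf0 : 0 ≤ Nf := Real.rpow_nonneg (integral_nonneg fun x ↦ by positivity) _
  have h1θ : 0 < 1 - c₁ * N := by linarith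
  have hsc : 0 ≤ Real.sqrt c₁ := Real.sqrt_nonneg _
  -- integrability of `f₋^{3/2}`
  have hfmi : Integrable (fun x ↦ max (-f x) 0 ^ (3 / 2 : ℝ)) μ := by
    refine hfi.mono (((hf.neg.max continuous_const).rpow_const
      fun x ↦ Or.inr (by norm_num)).aestronglyMeasurable) (Eventually.of_forall fun x ↦ ?_)
    rw [Real.norm_of_nonneg (Real.rpow_nonneg (le_max_right _ _) _),
      Real.norm_of_nonneg (Real.rpow_nonneg (abs_nonneg _) _)]
    refine Real.rpow_le_rpow (le_max_right _ _) ?_ (by norm_num)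
    exact max_le (neg_le_abs (f x)) (abs_nonneg _)
  /- the Dirichlet pairing `P u w = ∫ h⁻¹(du, dw) dV` -/
  obtain ⟨P, hP⟩ : ∃ P : (X → ℝ) → (X → ℝ) → ℝ, ∀ u w, P u w =
      ∫ x, D.metric.innerDual x (mvfderiv (𝓡 3) u x).toLinearMap
        (mvfderiv (𝓡 3) w x).toLinearMap ∂μ := ⟨_, fun _ _ ↦ rfl⟩
  have hPint : ∀ {u w : X → ℝ}, ContMDiff (𝓡 3) 𝓘(ℝ, ℝ) 1 u → HasCompactSupport u →
      ContMDiff (𝓡 3) 𝓘(ℝ, ℝ) 1 w → Integrable (fun x ↦ D.metric.innerDual x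
        (mvfderiv (𝓡 3) u x).toLinearMap (mvfderiv (𝓡 3) w x).toLinearMap) μ :=
    fun hu huc hw ↦ (continuous_innerDual_mvfderiv D.metric hu hw).integrable_of_hasCompactSupport
      (hasCompactSupport_innerDual_mvfderiv D huc)
  have hPcomm : ∀ u w, P u w = P w u := fun u w ↦ by
    rw [hP, hP]
    exact integral_congr_ae (Eventually.of_forall fun x ↦ innerDual_mvfderiv_comm D x u w)
  have hPadd : ∀ {u v w : X → ℝ}, ContMDiff (𝓡 3) 𝓘(ℝ, ℝ) 1 u → HasCompactSupport u →
      ContMDiff (𝓡 3) 𝓘(ℝ, ℝ) 1 v → HasCompactSupport v → ContMDiff (𝓡 3) 𝓘(ℝ, ℝ) 1 w →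
      P (u + v) w = P u w + P v w := by
    intro u v w hu huc hv hvc hw
    rw [hP, hP, hP, ← integral_add (hPint hu huc hw) (hPint hv hvc hw)]
    refine integral_congr_ae (Eventually.of_forall fun x ↦ ?_)
    exact innerDual_mvfderiv_add_left D x ((hu x).mdifferentiableAt one_ne_zero)
      ((hv x).mdifferentiableAt one_ne_zero)
  have hPsmul : ∀ {u w : X → ℝ} (c : ℝ), ContMDiff (𝓡 3) 𝓘(ℝ, ℝ) 1 u →
      P (c • u) w = c * P u w := by
    intro u w c hu
    rw [hP, hP, ← integral_const_mul]
    refine integral_congr_ae (Eventually.of_forall fun x ↦ ?_)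
    exact innerDual_mvfderiv_smul_left D x ((hu x).mdifferentiableAt one_ne_zero) c
  have hPnonneg : ∀ u, 0 ≤ P u u := fun u ↦ by
    rw [hP]; exact integral_nonneg fun x ↦ innerDual_mvfderiv_self_nonneg D x u
  have hSP : ∀ {ζ : X → ℝ}, ContMDiff (𝓡 3) 𝓘(ℝ, ℝ) 1 ζ → HasCompactSupport ζ →
      (∫ x, |ζ x| ^ 6 ∂μ) ^ (1 / 3 : ℝ) ≤ c₁ * P ζ ζ := fun hζ hζc ↦ by rw [hP]; exact hS _ hζ hζc
  /- the test space `W = C²_c(X)` as a submodule of `C²(X)` (no topology on the carrier) -/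
  obtain ⟨W, hW⟩ : ∃ W : Submodule ℝ (ContMDiffMap (𝓡 3) 𝓘(ℝ, ℝ) X ℝ 2),
      ∀ φ : ContMDiffMap (𝓡 3) 𝓘(ℝ, ℝ) X ℝ 2, φ ∈ W ↔ HasCompactSupport ⇑φ := by
    refine ⟨⟨⟨⟨setOf fun φ ↦ HasCompactSupport ⇑φ, ?_⟩, ?_⟩, ?_⟩, fun φ ↦ Iff.rfl⟩
    · intro a b ha hb
      exact ha.add hb
    · exact HasCompactSupport.zero
    · intro c φ hφ
      exact HasCompactSupport.intro hφ fun x hx ↦ by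
        simp [image_eq_zero_of_notMem_tsupport hx]
  obtain ⟨ev, hev⟩ : ∃ ev : W → X → ℝ, ∀ φ, ev φ = ⇑(φ : ContMDiffMap (𝓡 3) 𝓘(ℝ, ℝ) X ℝ 2) :=
    ⟨_, fun _ ↦ rfl⟩
  have hev2 : ∀ φ : W, ContMDiff (𝓡 3) 𝓘(ℝ, ℝ) 2 (ev φ) := fun φ ↦ by
    rw [hev]; exact (φ : ContMDiffMap (𝓡 3) 𝓘(ℝ, ℝ) X ℝ 2).contMDiff
  have hev1 : ∀ φ : W, ContMDiff (𝓡 3) 𝓘(ℝ, ℝ) 1 (ev φ) := fun φ ↦ (hev2 φ).of_le one_le_two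
  have hevc : ∀ φ : W, HasCompactSupport (ev φ) := fun φ ↦ by rw [hev]; exact (hW _).1 φ.2
  have hevcont : ∀ φ : W, Continuous (ev φ) := fun φ ↦ (hev2 φ).continuous
  have hev_add : ∀ φ ψ : W, ev (φ + ψ) = ev φ + ev ψ := fun φ ψ ↦ by rw [hev, hev, hev]; rfl
  have hev_smul : ∀ (c : ℝ) (φ : W), ev (c • φ) = c • ev φ := fun c φ ↦ by rw [hev, hev]; rfl
  have hev_sub : ∀ φ ψ : W, ev (φ - ψ) = ev φ - ev ψ := fun φ ψ ↦ by rw [hev, hev, hev]; rfl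
  have hev_zero : ev 0 = 0 := by rw [hev]; rfl
  have hev_inj : ∀ φ ψ : W, ev φ = ev ψ → φ = ψ := fun φ ψ h ↦ by
    rw [hev, hev] at h
    exact Subtype.ext (DFunLike.coe_injective h)
  have hev_mk : ∀ ζ : X → ℝ, ContMDiff (𝓡 3) 𝓘(ℝ, ℝ) 2 ζ → HasCompactSupport ζ →
      ∃ φ : W, ev φ = ζ := fun ζ hζ hζc ↦
    ⟨⟨⟨ζ, hζ⟩, (hW _).2 hζc⟩, by rw [hev]; rfl⟩
  /- the Dirichlet inner product on `W` -/
  have hip_add : ∀ φ ψ χ : W, P (ev (φ + ψ)) (ev χ) = P (ev φ) (ev χ) + P (ev ψ) (ev χ) :=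
    fun φ ψ χ ↦ by rw [hev_add]; exact hPadd (hev1 φ) (hevc φ) (hev1 ψ) (hevc ψ) (hev1 χ)
  have hip_smul : ∀ (c : ℝ) (φ χ : W), P (ev (c • φ)) (ev χ) = c * P (ev φ) (ev χ) :=
    fun c φ χ ↦ by rw [hev_smul]; exact hPsmul c (hev1 φ)
  have hip_def : ∀ φ : W, P (ev φ) (ev φ) = 0 → φ = 0 := by
    intro φ h0
    have h6 : (∫ x, |ev φ x| ^ 6 ∂μ) ^ (1 / 3 : ℝ) ≤ 0 := by
      have := hSP (hev1 φ) (hevc φ); rwa [h0, mul_zero] at this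
    have hI0 : 0 ≤ ∫ x, |ev φ x| ^ 6 ∂μ := integral_nonneg fun x ↦ by positivity
    have hI : ∫ x, |ev φ x| ^ 6 ∂μ = 0 := by
      have h' : (∫ x, |ev φ x| ^ 6 ∂μ) ^ (1 / 3 : ℝ) = 0 :=
        le_antisymm h6 (Real.rpow_nonneg hI0 _)
      exact (Real.rpow_eq_zero hI0 (by norm_num)).1 h'
    have hint : Integrable (fun x ↦ |ev φ x| ^ 6) μ := by
      have hc6 : HasCompactSupport (fun x ↦ |ev φ x| ^ 6) :=
        (hevc φ).comp_left (g := fun t : ℝ ↦ |t| ^ 6) (by simp)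
      exact ((hevcont φ).abs.pow 6).integrable_of_hasCompactSupport hc6
    have hae := (integral_eq_zero_iff_of_nonneg (fun x ↦ by positivity) hint).1 hI
    have hfun : (fun x ↦ |ev φ x| ^ 6) = fun _ ↦ (0 : ℝ) :=
      (Continuous.ae_eq_iff_eq μ ((hevcont φ).abs.pow 6) continuous_const).1 hae
    apply hev_inj
    rw [hev_zero]
    funext x
    have hx := congr_fun hfun x
    have hx0 : ev φ x = 0 := by
      have h6 : |ev φ x| ^ 6 = 0 := hx
      exact abs_eq_zero.1 ((pow_eq_zero_iff (by norm_num)).1 h6)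
    simpa using hx0
  obtain ⟨core, hcore⟩ : ∃ core : InnerProductSpace.Core ℝ W,
      ∀ φ ψ, core.inner φ ψ = P (ev φ) (ev ψ) :=
    ⟨{ inner := fun φ ψ ↦ P (ev φ) (ev ψ)
       conj_inner_symm := fun φ ψ ↦ by simp [hPcomm (ev φ) (ev ψ)]
       re_inner_nonneg := fun φ ↦ by simpa using hPnonneg (ev φ)
       add_left := hip_add
       smul_left := fun φ ψ r ↦ by simpa using hip_smul r φ ψ
       definite := hip_def }, fun _ _ ↦ rfl⟩
  letI i1 : NormedAddCommGroup W := @InnerProductSpace.Core.toNormedAddCommGroup ℝ W _ _ _ core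
  letI i2 : InnerProductSpace ℝ W := InnerProductSpace.ofCore core.toCore
  have hinner : ∀ φ ψ : W, ⟪φ, ψ⟫ = P (ev φ) (ev ψ) := fun φ ψ ↦ hcore φ ψ
  have hnormsq : ∀ φ : W, ‖φ‖ ^ 2 = P (ev φ) (ev φ) := fun φ ↦ by
    rw [← real_inner_self_eq_norm_sq, hinner]
  have hnorm : ∀ φ : W, ‖φ‖ = Real.sqrt (P (ev φ) (ev φ)) := fun φ ↦ by
    rw [← hnormsq, Real.sqrt_sq (norm_nonneg _)]
  -- Sobolev: `‖ev φ‖₆ ≤ √c₁ ‖φ‖`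
  have hS6 : ∀ φ : W, (∫ x, |ev φ x| ^ 6 ∂μ) ^ (1 / 6 : ℝ) ≤ Real.sqrt c₁ * ‖φ‖ := by
    intro φ
    have h := lSix_le_sqrt_of_sobolev D hS (hev1 φ) (hevc φ)
    rw [← hP, Real.sqrt_mul hc₁, ← hnorm] at h
    exact h
  /- the bilinear form `B₀ φ ψ = ⟨φ, ψ⟩ + ∫ f φ ψ` and the functional `ℓ₀ ψ = −∫ g ψ` -/
  have hq_int : ∀ φ ψ : W, Integrable (fun x ↦ f x * ev φ x * ev ψ x) μ := fun φ ψ ↦ by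
    have hcs : HasCompactSupport (fun x ↦ f x * ev φ x * ev ψ x) := (hevc ψ).mul_left
    exact ((hf.mul (hevcont φ)).mul (hevcont ψ)).integrable_of_hasCompactSupport hcs
  have hq_add : ∀ φ ψ χ : W, ∫ x, f x * ev (φ + ψ) x * ev χ x ∂μ =
      ∫ x, f x * ev φ x * ev χ x ∂μ + ∫ x, f x * ev ψ x * ev χ x ∂μ := by
    intro φ ψ χ
    rw [← integral_add (hq_int φ χ) (hq_int ψ χ), hev_add]
    refine integral_congr_ae (Eventually.of_forall fun x ↦ ?_)
    simp only [Pi.add_apply]; ring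
  have hq_smul : ∀ (c : ℝ) (φ χ : W), ∫ x, f x * ev (c • φ) x * ev χ x ∂μ =
      c * ∫ x, f x * ev φ x * ev χ x ∂μ := by
    intro c φ χ
    rw [← integral_const_mul, hev_smul]
    refine integral_congr_ae (Eventually.of_forall fun x ↦ ?_)
    simp only [Pi.smul_apply, smul_eq_mul]; ring
  have hq_symm : ∀ φ ψ : W, ∫ x, f x * ev φ x * ev ψ x ∂μ = ∫ x, f x * ev ψ x * ev φ x ∂μ :=
    fun φ ψ ↦ integral_congr_ae (Eventually.of_forall fun x ↦ by ring)
  have hq_bound : ∀ φ ψ : W, |∫ x, f x * ev φ x * ev ψ x ∂μ| ≤ c₁ * Nf * ‖φ‖ * ‖ψ‖ := by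
    intro φ ψ
    have h := abs_integral_potential_le_of_sobolev D hc₁ hS hf hfi (hev1 φ) (hevc φ) (hev1 ψ)
      (hevc ψ)
    rw [← hP, ← hP, ← hnorm, ← hnorm] at h
    exact h
  have hBex : ∃ B₀ : W →L[ℝ] W →L[ℝ] ℝ, ∀ φ ψ, B₀ φ ψ = ⟪φ, ψ⟫ + ∫ x, f x * ev φ x * ev ψ x ∂μ := by
    refine ⟨LinearMap.mkContinuous₂
      (LinearMap.mk₂ ℝ (fun φ ψ ↦ ⟪φ, ψ⟫ + ∫ x, f x * ev φ x * ev ψ x ∂μ) ?_ ?_ ?_ ?_)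
        (1 + c₁ * Nf) ?_, fun φ ψ ↦ rfl⟩
    · intro φ ψ χ
      rw [inner_add_left, hq_add]; ring
    · intro c φ χ
      rw [real_inner_smul_left, hq_smul]; ring
    · intro φ ψ χ
      rw [inner_add_right, hq_symm, hq_add, hq_symm χ, hq_symm ψ]; ring
    · intro c φ χ
      rw [real_inner_smul_right, hq_symm, hq_smul, hq_symm]; ring
    · intro φ ψ
      simp only [LinearMap.mk₂_apply, Real.norm_eq_abs]
      calc |⟪φ, ψ⟫ + ∫ x, f x * ev φ x * ev ψ x ∂μ|
          ≤ |⟪φ, ψ⟫| + |∫ x, f x * ev φ x * ev ψ x ∂μ| := abs_add_le _ _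
        _ ≤ ‖φ‖ * ‖ψ‖ + c₁ * Nf * ‖φ‖ * ‖ψ‖ := add_le_add (abs_real_inner_le_norm φ ψ) (hq_bound φ ψ)
        _ = (1 + c₁ * Nf) * ‖φ‖ * ‖ψ‖ := by ring
  obtain ⟨B₀, hB₀⟩ := hBex
  have hℓ_int : ∀ ψ : W, Integrable (fun x ↦ g x * ev ψ x) μ := fun ψ ↦ by
    have hcs : HasCompactSupport (fun x ↦ g x * ev ψ x) := (hevc ψ).mul_left
    exact (hg.mul (hevcont ψ)).integrable_of_hasCompactSupport hcs
  have hℓ_bound : ∀ ψ : W, |∫ x, g x * ev ψ x ∂μ| ≤ G * Real.sqrt c₁ * ‖ψ‖ := by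
    intro ψ
    have h := abs_integral_source_le_of_sobolev D hS hg hgi (hev1 ψ) (hevc ψ)
    rw [← hP, Real.sqrt_mul hc₁, ← hnorm] at h
    calc |∫ x, g x * ev ψ x ∂μ| ≤ G * (Real.sqrt c₁ * ‖ψ‖) := h
      _ = G * Real.sqrt c₁ * ‖ψ‖ := by ring
  have hℓex : ∃ ℓ₀ : W →L[ℝ] ℝ, ∀ ψ, ℓ₀ ψ = -∫ x, g x * ev ψ x ∂μ := by
    refine ⟨LinearMap.mkContinuous
      { toFun := fun ψ ↦ -∫ x, g x * ev ψ x ∂μ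
        map_add' := ?_
        map_smul' := ?_ } (G * Real.sqrt c₁) ?_, fun ψ ↦ rfl⟩
    · intro φ ψ
      rw [hev_add, ← neg_add, ← integral_add (hℓ_int φ) (hℓ_int ψ)]
      congr 1
      refine integral_congr_ae (Eventually.of_forall fun x ↦ ?_)
      simp only [Pi.add_apply]; ring
    · intro c ψ
      simp only [RingHom.id_apply, smul_eq_mul]
      rw [hev_smul, mul_neg, ← integral_const_mul]
      congr 1
      refine integral_congr_ae (Eventually.of_forall fun x ↦ ?_)
      simp only [Pi.smul_apply, smul_eq_mul]; ring
    · intro ψ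
      simp only [LinearMap.coe_mk, AddHom.coe_mk, Real.norm_eq_abs, abs_neg]
      exact hℓ_bound ψ
  obtain ⟨ℓ₀, hℓ₀⟩ := hℓex
  have hℓnorm : ‖ℓ₀‖ ≤ G * Real.sqrt c₁ :=
    ContinuousLinearMap.opNorm_le_bound _ (by positivity) fun ψ ↦ by
      rw [hℓ₀, Real.norm_eq_abs, abs_neg]; exact hℓ_bound ψ
  /- coercivity: `B₀ φ φ ≥ (1 − θ) ‖φ‖²` -/
  have hcoer : ∀ φ : W, (1 - c₁ * N) * ‖φ‖ ^ 2 ≤ B₀ φ φ := by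
    intro φ
    rw [hB₀, real_inner_self_eq_norm_sq]
    have hneg : -(N * (c₁ * P (ev φ) (ev φ))) ≤ ∫ x, f x * ev φ x * ev φ x ∂μ := by
      have h1 := integral_negPart_mul_sq_le_of_sobolev D hS hf hfmi (hev1 φ) (hevc φ)
      rw [← hP] at h1
      have h2 : -∫ x, max (-f x) 0 * ev φ x ^ 2 ∂μ ≤ ∫ x, f x * ev φ x * ev φ x ∂μ := by
        rw [← integral_neg]
        have hi1 : Integrable (fun x ↦ -(max (-f x) 0 * ev φ x ^ 2)) μ := by
          have h2c : HasCompactSupport (fun x ↦ ev φ x ^ 2) :=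
            (hevc φ).comp_left (g := fun t : ℝ ↦ t ^ 2) (by simp)
          have hcs : HasCompactSupport (fun x ↦ max (-f x) 0 * ev φ x ^ 2) := h2c.mul_left
          have hi0 : Integrable (fun x ↦ max (-f x) 0 * ev φ x ^ 2) μ :=
            ((hf.neg.max continuous_const).mul ((hevcont φ).pow 2)).integrable_of_hasCompactSupport
              hcs
          exact hi0.neg
        refine integral_mono hi1 (hq_int φ φ) fun x ↦ ?_
        have hx : -max (-f x) 0 ≤ f x := by
          rw [neg_le]; exact le_max_left _ _
        have := mul_le_mul_of_nonneg_right hx (sq_nonneg (ev φ x))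
        calc -(max (-f x) 0 * ev φ x ^ 2) = -max (-f x) 0 * ev φ x ^ 2 := by ring
          _ ≤ f x * ev φ x ^ 2 := this
          _ = f x * ev φ x * ev φ x := by ring
      linarith
    rw [← hnormsq] at hneg
    nlinarith [hneg, sq_nonneg ‖φ‖]
  /- Lax–Milgram: a Cauchy sequence of test functions -/
  obtain ⟨v, hvC, hvB, L, hL, hvL⟩ := exists_cauchySeq_tendsto_of_coercive B₀ ℓ₀ h1θ hcoer
  /- passage to `L⁶` -/
  have hmem : ∀ φ : W, MemLp (ev φ) 6 μ := fun φ ↦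
    (hevcont φ).memLp_of_hasCompactSupport (hevc φ)
  obtain ⟨T, hT⟩ : ∃ T : W → Lp ℝ 6 μ, ∀ φ, T φ = (hmem φ).toLp (ev φ) := ⟨_, fun _ ↦ rfl⟩
  have hTsub : ∀ φ ψ : W, T φ - T ψ = T (φ - ψ) := by
    intro φ ψ
    rw [hT, hT, hT, ← MemLp.toLp_sub (hmem φ) (hmem ψ)]
    exact MemLp.toLp_congr _ _ (by rw [hev_sub])
  have hTnorm : ∀ φ : W, ‖T φ‖ = (∫ x, |ev φ x| ^ 6 ∂μ) ^ (1 / 6 : ℝ) := fun φ ↦ by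
    rw [hT]; exact norm_toLp_six_eq (hevcont φ) (hevc φ)
  have hTle : ∀ φ : W, ‖T φ‖ ≤ Real.sqrt c₁ * ‖φ‖ := fun φ ↦ by rw [hTnorm]; exact hS6 φ
  have hTC : CauchySeq fun n ↦ T (v n) := by
    rw [Metric.cauchySeq_iff] at hvC ⊢
    intro ε hε
    obtain ⟨M, hM⟩ := hvC (ε / (Real.sqrt c₁ + 1)) (by positivity)
    refine ⟨M, fun m hm n hn ↦ ?_⟩
    have hmn := hM m hm n hn
    rw [dist_eq_norm] at hmn ⊢
    rw [hTsub]
    calc ‖T (v m - v n)‖ ≤ Real.sqrt c₁ * ‖v m - v n‖ := hTle _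
      _ ≤ Real.sqrt c₁ * (ε / (Real.sqrt c₁ + 1)) := mul_le_mul_of_nonneg_left hmn.le hsc
      _ < ε := by
          rw [mul_div_assoc', div_lt_iff₀ (by positivity)]
          nlinarith
  obtain ⟨U, hU⟩ := cauchySeq_tendsto_of_complete hTC
  -- the norm of the limit
  have hUnorm : ‖U‖ ≤ Real.sqrt c₁ * L :=
    le_of_tendsto_of_tendsto' ((continuous_norm.tendsto U).comp hU) (hvL.const_mul _)
      fun n ↦ hTle (v n)
  have hUle : ‖U‖ ≤ c₁ * G / (1 - c₁ * N) := by
    calc ‖U‖ ≤ Real.sqrt c₁ * L := hUnorm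
      _ ≤ Real.sqrt c₁ * (‖ℓ₀‖ / (1 - c₁ * N)) := mul_le_mul_of_nonneg_left hL hsc
      _ ≤ Real.sqrt c₁ * (G * Real.sqrt c₁ / (1 - c₁ * N)) := by
          gcongr
      _ = c₁ * G / (1 - c₁ * N) := by
          rw [mul_div_assoc', show Real.sqrt c₁ * (G * Real.sqrt c₁) = (Real.sqrt c₁ * Real.sqrt c₁) * G
            by ring, Real.mul_self_sqrt hc₁]
  refine ⟨U, Lp.memLp U, ?_, ?_⟩
  · rw [integral_pow_six_eq_norm_pow]
    exact pow_le_pow_left₀ (norm_nonneg _) hUle 6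
  /- the distributional identity -/
  intro ζ hζ hζc
  obtain ⟨φζ, hφζ⟩ := hev_mk ζ hζ hζc
  have hζ1 : ContMDiff (𝓡 3) 𝓘(ℝ, ℝ) 1 ζ := hζ.of_le one_le_two
  have hζcont : Continuous ζ := hζ.continuous
  -- the test integrand `ψ = f ζ − Δ_h ζ`
  obtain ⟨ψ, hψ⟩ : ∃ ψ : X → ℝ, ψ = fun x ↦ f x * ζ x - D.metric.dalembertian ζ x := ⟨_, rfl⟩
  have hΔc : Continuous (D.metric.dalembertian ζ) := continuous_dalembertian D.metric hζ
  have hψc : Continuous ψ := by rw [hψ]; exact (hf.mul hζcont).sub hΔc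
  have hψcs : HasCompactSupport ψ := by
    rw [hψ]
    refine HasCompactSupport.intro hζc fun x hx ↦ ?_
    rw [image_eq_zero_of_notMem_tsupport hx, mul_zero,
      PseudoRiemannianMetric.dalembertian_eq_zero_of_notMem_tsupport D.metric hx, sub_zero]
  -- `B₀ (v n) φζ = ∫ ψ · v n`
  have hBψ : ∀ n, B₀ (v n) φζ = ∫ x, ψ x * T (v n) x ∂μ := by
    intro n
    have hGreen : ∫ x, ev (v n) x * D.metric.dalembertian ζ x ∂μ =
        -∫ x, D.metric.innerDual x (mvfderiv (𝓡 3) (ev (v n)) x).toLinearMap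
          (mvfderiv (𝓡 3) ζ x).toLinearMap ∂μ :=
      integral_mul_dalembertian_eq_neg_integral_innerDual_of_hasCompactSupport D.h (hev1 (v n))
        (hevc (v n)) hζ
    have hi1 : Integrable (fun x ↦ ev (v n) x * D.metric.dalembertian ζ x) μ := by
      have hcs : HasCompactSupport (fun x ↦ ev (v n) x * D.metric.dalembertian ζ x) :=
        (hevc (v n)).mul_right
      exact ((hevcont (v n)).mul hΔc).integrable_of_hasCompactSupport hcs
    have hi2 : Integrable (fun x ↦ f x * ev (v n) x * ζ x) μ := by
      have := hq_int (v n) φζ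
      rwa [hφζ] at this
    have hae : (fun x ↦ ψ x * T (v n) x) =ᵐ[μ] fun x ↦ ψ x * ev (v n) x := by
      filter_upwards [show (T (v n) : X → ℝ) =ᵐ[μ] ev (v n) from by
        rw [hT]; exact (hmem (v n)).coeFn_toLp] with x hx
      rw [hx]
    rw [integral_congr_ae hae, hB₀, hinner, hP, hφζ]
    rw [show (∫ x, D.metric.innerDual x (mvfderiv (𝓡 3) (ev (v n)) x).toLinearMap
        (mvfderiv (𝓡 3) ζ x).toLinearMap ∂μ) = -∫ x, ev (v n) x * D.metric.dalembertian ζ x ∂μ by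
      rw [hGreen, neg_neg]]
    have hi1' : Integrable (fun x ↦ -(ev (v n) x * D.metric.dalembertian ζ x)) μ := hi1.neg
    rw [← integral_neg, ← integral_add hi1' hi2]
    refine integral_congr_ae (Eventually.of_forall fun x ↦ ?_)
    rw [hψ]
    ring
  have hlim1 : Tendsto (fun n ↦ ∫ x, ψ x * T (v n) x ∂μ) atTop (𝓝 (∫ x, ψ x * U x ∂μ)) :=
    tendsto_integral_mul_of_tendsto_Lp hU hψc hψcs
  have hlim2 : Tendsto (fun n ↦ ∫ x, ψ x * T (v n) x ∂μ) atTop (𝓝 (ℓ₀ φζ)) := by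
    have := hvB φζ
    simp_rw [hBψ] at this
    exact this
  have heq : ∫ x, ψ x * U x ∂μ = -∫ x, g x * ζ x ∂μ := by
    rw [tendsto_nhds_unique hlim1 hlim2, hℓ₀, hφζ]
  calc ∫ x, U x * (D.metric.dalembertian ζ x - f x * ζ x) ∂μ
      = ∫ x, -(ψ x * U x) ∂μ := by
        refine integral_congr_ae (Eventually.of_forall fun x ↦ ?_)
        rw [hψ]; ring
    _ = ∫ x, g x * ζ x ∂μ := by rw [integral_neg, heq, neg_neg]

end Existence

end Literature.Geometry.Lorentzian
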